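import Summits.Ventures.PercRepro.ProfilePointedCircuitClassesStarSharpDefectC
import Summits.Ventures.PercRepro.ProfilePointedCircuitClassesStarSharpLoopC

/-!
# PercRepro — THE ALL-ON CORE OF `StarNineSharp` (THE LOOP REGIME OF D0), PART G: AT MOST THREE DEFECTS
(p5, gen 55; `proofs/P5-GM1.md` §82 ADD 3)

`inCount_thru_le_of_loop_of_le_three_bad`: the loop regime (`ρ{b, b′} = 1`, every set ON) with at most three
demands without a swap — every loop configuration of the catalogue (`|bad| ≤ 3` on all 1,490) — satisfies the
`b′`-avoiding inequality: the generic defect count (`card_bad_le_targets_of_card_le_three_P`, DefectC) with the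
class `P = ¬ d0c0` (the defects of `R`, `defect_data_of_loop`) and the ON targets `{e, f, x} + b`
(`cpoint_target_mem_of_loop`), assembled by `inCount_thru_le_of_loop_of_bad_bound`.
-/

open scoped Matroid

namespace PercRepro.Cogirth

open Finset ThmH Skew Shadow Profile

open Classical

variable {α : Type} [DecidableEq α] {N : Matroid α} [N.Finite]

section StarSharpLoopG

variable {b b' : α}

/-- **THE LOOP REGIME WITH AT MOST THREE DEFECTS**: `ρ{b, b′} = 1` (every set ON), at most three demands without a
swap (every loop configuration of the catalogue); then the `b′`-avoiding inequality holds. -/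
theorem inCount_thru_le_of_loop_of_le_three_bad (hn : (gr N).card = 9) (h : SeriesPair N b b')
    {e f : α} (he : e ∈ gr N) (hf : f ∈ gr N) (hef : e ≠ f) (heb : e ≠ b) (heb' : e ≠ b') (hfb : f ≠ b) (hfb' : f ≠ b')
    (he1 : ∀ y ∈ ((((gr N).erase b).erase b').erase f).erase e, rk N {e, y} = 2)
    (hf1 : ∀ y ∈ ((((gr N).erase b).erase b').erase f).erase e, rk N {f, y} = 2)
    (hfc : ∀ y ∈ ((((gr N).erase b).erase b').erase f).erase e, rk N (((((gr N).erase b).erase b').erase f).erase y) = 4)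
    (hX : rk N (((((gr N).erase b).erase b').erase f).erase e) = 4) (hef2 : rk N {e, f} = 2)
    (hbb : rk N {b, b'} = 1)
    (hthree : ∀ W₁ ∈ d0DON N b' e f, ∀ W₂ ∈ d0DON N b' e f, ∀ W₃ ∈ d0DON N b' e f, ∀ W₄ ∈ d0DON N b' e f,
      ¬ d0c0 N b b' e f W₁ → ¬ d0c0 N b b' e f W₂ → ¬ d0c0 N b b' e f W₃ → ¬ d0c0 N b b' e f W₄ →
      W₁ = W₂ ∨ W₁ = W₃ ∨ W₁ = W₄ ∨ W₂ = W₃ ∨ W₂ = W₄ ∨ W₃ = W₄) :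
    inCount N 4 e + thruCount N 4 {b', f} + thruCount N 4 {b', e, f} ≤
      inCount N 4 f + thruCount N 4 {e, f} + thruCount N 4 {b', e} := by
  apply inCount_thru_le_of_loop_of_bad_bound hn h he hf hef heb heb' hfb hfb'
  have hbadC := defect_data_of_loop hn h he hf hef heb heb' hfb hfb' he1 hf1 hX hef2 hbb
  apply card_bad_le_targets_of_card_le_three_P hn h he hf hef heb heb' hfb hfb' he1 hf1 hfc hX hef2
    (P := fun W => ¬ d0c0 N b b' e f W) (fun W hW => (hbadC W (mem_filter.2 (mem_filter.1 hW))).2.2.2.2.2.1)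
    (fun x hx hefx hx4 => cpoint_target_mem_of_loop h hn hbb he hf hef heb heb' hfb hfb' hx hefx hx4)
  apply card_le_three_of_no_four
  intro x hx y hy z hz w hw
  simp only [mem_filter] at hx hy hz hw
  exact hthree x hx.1 y hy.1 z hz.1 w hw.1 hx.2 hy.2 hz.2 hw.2

end StarSharpLoopG

end PercRepro.Cogirth
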